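import Mathlib
import Literature.NumberTheory.Transcendental.KZCalculus
import Literature.NumberTheory.Transcendental.SemialgebraicMapsProofs
import Literature.NumberTheory.Transcendental.KZProductIdeal
import Literature.NumberTheory.Transcendental.EllIterRep
import HarnessLib

/-!
# Stub `stub_haarReps` — crux `TorsionLogs.NeronTorsionSector`, line `registered` (block S3)

Representation constructors on the identity component `x > e₁` of the real curve
`y² = f(x) = 4x³ − g₂x − g₃` (algebraic coefficients, `f > 0` on `(e₁, ∞)`, `e₁` algebraic,
`1/√f` integrable on `(e₁, ∞)`):

1. for a `ℚ`-semialgebraic `A ⊆ (e₁, ∞)` and a `ℚ`-semialgebraic bounded `g` on `A`, the datum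
   `[A, g(x) dx/√f(x)]` is a Kontsevich–Zagier representation (`KZ.IntegralRep 1`);
2. for a `ℚ`-semialgebraic `B ⊆ (e₁, ∞)`, a `ℚ`-semialgebraic bounded `g` on `B` and a
   `ℚ`-semialgebraic `S ⊆ (e₁, ∞) × B`, the datum `[S, g(x′) dx dx′/(√f(x)√f(x′))]` is a
   Kontsevich–Zagier representation (`KZ.IntegralRep 2`).

Semialgebraicity of the integrands is the closure of real `ℚ`-semialgebraic functions under
`+`, `*`, `/`, `√` and composition with coordinate projections (Bochnak–Coste–Roy, Prop. 2.2.6, all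
proved in the tree from Tarski–Seidenberg); absolute convergence is domination by
`M · ∏ₖ (√f(xₖ))⁻¹`, a product of integrable functions of separate variables
(`MeasureTheory.Integrable.fintype_prod`), measurability of the integrand coming from its
semialgebraicity (`IsSemialgebraicFunOn.measurable_holds`).

References: M. Kontsevich, D. Zagier, *Periods* (2001), §1.1; J. Bochnak, M. Coste, M.-F. Roy,
*Real Algebraic Geometry* (1998), §2.2, Prop. 2.2.6.
-/

noncomputable section

-- `Summit.KontsevichZagierPeriods.KontsevichZagierPeriods.…` is the tree's mandated layout (single-conjunct summit).
set_option linter.dupNamespace false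

open Set MeasureTheory MvPolynomial
open Literature.NumberTheory.Transcendental Literature.ModelTheory.ExponentialFields

namespace Summit.KontsevichZagierPeriods.KontsevichZagierPeriods.Cruxes.NeronTorsionSector.Translation

/-- **The Weierstrass cubic in one coordinate is `ℚ`-semialgebraic.** If `f(x) = 4x³ − g₂x − g₃` with
`g₂, g₃` algebraic over `ℚ`, then `x ↦ f(x k)` is a `ℚ`-semialgebraic function on every
`ℚ`-semialgebraic `s ⊆ ℝⁿ` (real algebraic constants are `ℚ`-definable,
`isSemialgebraicFunOn_const_of_isAlgebraic`; closure under `*`, `−`).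
[cite: BochnakCosteRoy1998, Prop. 2.2.6] -/
theorem isSemialgebraicFunOn_cubic_apply {n : ℕ} {s : Set (Fin n → ℝ)} (hs : IsSemialgebraic ℚ s)
    {g₂ g₃ : ℝ} (h₂ : IsAlgebraic ℚ g₂) (h₃ : IsAlgebraic ℚ g₃) {f : ℝ → ℝ}
    (hf : ∀ x, f x = 4 * x ^ 3 - g₂ * x - g₃) (k : Fin n) :
    IsSemialgebraicFunOn ℚ s (fun x => f (x k)) := by
  have hX : IsSemialgebraicFunOn ℚ s (fun x => x k) :=
    (isSemialgebraicFunOn_aeval hs (X k)).congr fun x _ => by simp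
  have hX3 : IsSemialgebraicFunOn ℚ s (fun x => 4 * x k ^ 3) :=
    (isSemialgebraicFunOn_aeval hs (C 4 * X k ^ 3)).congr fun x _ => by simp
  have hg₂x := IsSemialgebraicFunOn.mul_holds (isSemialgebraicFunOn_const_of_isAlgebraic hs h₂) hX
  have hg₃ := isSemialgebraicFunOn_const_of_isAlgebraic hs h₃
  have h := IsSemialgebraicFunOn.sub_holds (IsSemialgebraicFunOn.sub_holds hX3 hg₂x) hg₃
  exact h.congr fun x _ => by simp [hf]

/-- **`√f` in one coordinate is `ℚ`-semialgebraic** (`IsSemialgebraicFunOn.sqrt_holds` on top of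
`isSemialgebraicFunOn_cubic_apply`). [cite: BochnakCosteRoy1998, Prop. 2.2.6] -/
theorem isSemialgebraicFunOn_sqrt_cubic_apply {n : ℕ} {s : Set (Fin n → ℝ)}
    (hs : IsSemialgebraic ℚ s) {g₂ g₃ : ℝ} (h₂ : IsAlgebraic ℚ g₂) (h₃ : IsAlgebraic ℚ g₃)
    {f : ℝ → ℝ} (hf : ∀ x, f x = 4 * x ^ 3 - g₂ * x - g₃) (k : Fin n) :
    IsSemialgebraicFunOn ℚ s (fun x => Real.sqrt (f (x k))) :=
  IsSemialgebraicFunOn.sqrt_holds (isSemialgebraicFunOn_cubic_apply hs h₂ h₃ hf k)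

/-- **Domination by a product of one-variable integrable functions.** On a measurable `S ⊆ ℝⁿ`, a
function `F` which is measurable on `S` and bounded there by `M · ∏ₖ φ(zₖ)` with `φ` integrable on `ℝ`
is integrable on `S` (`MeasureTheory.Integrable.fintype_prod`, `Integrable.mono'`).
[cite: KontsevichZagier2001, §1.1] -/
theorem integrableOn_of_abs_le_const_mul_prod {n : ℕ} {φ : ℝ → ℝ} (hφ : Integrable φ)
    {S : Set (Fin n → ℝ)} (hS : MeasurableSet S) {F : (Fin n → ℝ) → ℝ}
    (hF : Measurable (S.restrict F)) (M : ℝ) (hbound : ∀ z ∈ S, |F z| ≤ M * ∏ k, φ (z k)) :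
    IntegrableOn F S := by
  have hG : Integrable (fun z : Fin n → ℝ => ∏ k, φ (z k)) (volume : Measure (Fin n → ℝ)) :=
    Integrable.fintype_prod (μ := fun _ : Fin n => (volume : Measure ℝ)) (f := fun _ => φ)
      fun _ => hφ
  refine Integrable.mono' ((hG.const_mul M).integrableOn) ?_ ?_
  · exact (aemeasurable_restrict_of_measurable_subtype hS hF).aestronglyMeasurable
  · filter_upwards [ae_restrict_mem hS] with z hz
    rw [Real.norm_eq_abs]
    exact hbound z hz

/-- **A `ℚ`-semialgebraic subset of `ℝⁿ` is Lebesgue measurable and a `ℚ`-semialgebraic function on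
it is measurable there** (semialgebraic sets are Borel; `IsSemialgebraicFunOn.measurable_holds`).
[cite: BochnakCosteRoy1998, §2.2] -/
theorem measurable_restrict_of_isSemialgebraicFunOn {n : ℕ} {S : Set (Fin n → ℝ)}
    {F : (Fin n → ℝ) → ℝ} (hF : IsSemialgebraicFunOn ℚ S F) : Measurable (S.restrict F) :=
  IsSemialgebraicFunOn.measurable_holds hF

/-- **STUB S3 (`stub_haarReps`) — representation constructors on the identity component.**
With `f = 4x³ − g₂x − g₃` (algebraic coefficients), `f > 0` on `(e₁, ∞)` (`e₁` algebraic) and `1/√f`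
integrable on `(e₁, ∞)`: (1) for a `ℚ`-semialgebraic `A ⊆ (e₁, ∞)` and a `ℚ`-semialgebraic, continuous,
bounded `g` on `A`, the datum `[A, g(x) dx/√f(x)]` is a KZ representation; (2) for a `ℚ`-semialgebraic
`B ⊆ (e₁, ∞)`, a `ℚ`-semialgebraic continuous bounded `g` on `B` and a `ℚ`-semialgebraic
`S ⊆ (e₁, ∞) × B`, the datum `[S, g(x′) dx dx′/(√f(x)√f(x′))]` is a KZ representation (semialgebraicity
by the closure rules `IsSemialgebraicFunOn.mul_holds/.div/.sqrt_holds/.comp_isSemialgebraicMapOn_holds`;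
integrability by domination with `M/(√f(x)√f(x′))`, a product of integrable functions
(`MeasureTheory.Integrable.fintype_prod`), measurability `IsSemialgebraicFunOn.measurable_holds`).
[cite: KontsevichZagier2001, §1.1] [cite: BochnakCosteRoy1998, Prop. 2.2.6] -/
theorem stub_haarReps :
    (∀ (g₂ g₃ e₁ M : ℝ) (f g : ℝ → ℝ) (A : Set ℝ),
      IsAlgebraic ℚ g₂ → IsAlgebraic ℚ g₃ → IsAlgebraic ℚ e₁ → (∀ x, f x = 4 * x ^ 3 - g₂ * x - g₃) →
      (∀ x, e₁ < x → 0 < f x) →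
      MeasureTheory.IntegrableOn (fun x => (Real.sqrt (f x))⁻¹) (Set.Ioi e₁) →
      A ⊆ Set.Ioi e₁ → IsSemialgebraic ℚ {t : Fin 1 → ℝ | t 0 ∈ A} →
      IsSemialgebraicFunOn ℚ {t : Fin 1 → ℝ | t 0 ∈ A} (fun t => g (t 0)) → ContinuousOn g A →
      (∀ x ∈ A, |g x| ≤ M) →
      ∃ r : Literature.NumberTheory.Transcendental.KZ.IntegralRep 1,
        r.domain = {t | t 0 ∈ A} ∧ r.integrand = fun t => g (t 0) / Real.sqrt (f (t 0))) ∧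
    (∀ (g₂ g₃ e₁ M : ℝ) (f g : ℝ → ℝ) (B : Set ℝ) (S : Set (Fin 2 → ℝ)),
      IsAlgebraic ℚ g₂ → IsAlgebraic ℚ g₃ → IsAlgebraic ℚ e₁ → (∀ x, f x = 4 * x ^ 3 - g₂ * x - g₃) →
      (∀ x, e₁ < x → 0 < f x) →
      MeasureTheory.IntegrableOn (fun x => (Real.sqrt (f x))⁻¹) (Set.Ioi e₁) →
      B ⊆ Set.Ioi e₁ → IsSemialgebraic ℚ {t : Fin 1 → ℝ | t 0 ∈ B} →
      IsSemialgebraicFunOn ℚ {t : Fin 1 → ℝ | t 0 ∈ B} (fun t => g (t 0)) → ContinuousOn g B →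
      (∀ x ∈ B, |g x| ≤ M) →
      IsSemialgebraic ℚ S → S ⊆ {z | e₁ < z 0 ∧ z 1 ∈ B} →
      ∃ r : Literature.NumberTheory.Transcendental.KZ.IntegralRep 2,
        r.domain = S ∧ r.integrand = fun z => g (z 1) / (Real.sqrt (f (z 0)) * Real.sqrt (f (z 1)))) := by
  refine ⟨?_, ?_⟩
  · intro g₂ g₃ e₁ M f g A h₂ h₃ _he₁ hf hpos hint hA hAsa hg _hgc hgM
    -- the integrand `g(t 0)/√f(t 0)` on `{t | t 0 ∈ A}`
    have hsqrt := isSemialgebraicFunOn_sqrt_cubic_apply hAsa h₂ h₃ hf 0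
    have hne : ∀ t ∈ {t : Fin 1 → ℝ | t 0 ∈ A}, Real.sqrt (f (t 0)) ≠ 0 := fun t ht =>
      (Real.sqrt_pos.2 (hpos _ (hA ht))).ne'
    have hsa : IsSemialgebraicFunOn ℚ {t : Fin 1 → ℝ | t 0 ∈ A}
        (fun t => g (t 0) / Real.sqrt (f (t 0))) := hg.div hsqrt hne
    have hmeasA : MeasurableSet {t : Fin 1 → ℝ | t 0 ∈ A} := IsSemialgebraic.measurableSet_holds hAsa
    have hint' : IntegrableOn (fun t : Fin 1 → ℝ => g (t 0) / Real.sqrt (f (t 0)))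
        {t : Fin 1 → ℝ | t 0 ∈ A} := by
      refine integrableOn_of_abs_le_const_mul_prod
        (hint.integrable_indicator measurableSet_Ioi) hmeasA
        (measurable_restrict_of_isSemialgebraicFunOn hsa) M fun t ht => ?_
      have ht' : t 0 ∈ Ioi e₁ := hA ht
      have hs0 : 0 < Real.sqrt (f (t 0)) := Real.sqrt_pos.2 (hpos _ ht')
      rw [Fin.prod_univ_one, indicator_of_mem ht', abs_div, abs_of_pos hs0, div_eq_mul_inv]
      exact mul_le_mul_of_nonneg_right (hgM _ ht) (inv_nonneg.2 hs0.le)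
    exact ⟨⟨{t | t 0 ∈ A}, fun t => g (t 0) / Real.sqrt (f (t 0)), hAsa, hsa, hint'⟩, rfl, rfl⟩
  · intro g₂ g₃ e₁ M f g B S h₂ h₃ he₁ hf hpos hint hB _hBsa hg _hgc hgM hS hSB
    -- the integrand `g(z 1)/(√f(z 0) √f(z 1))` on `S`
    have hZ1 : IsSemialgebraicFunOn ℚ S (fun z => z 1) :=
      (isSemialgebraicFunOn_aeval hS (X 1)).congr fun z _ => by simp
    have hproj : IsSemialgebraicMapOn ℚ S (fun z (_ : Fin 1) => z 1) :=
      IsSemialgebraicMapOn.of_forall hS fun _ => hZ1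
    have hgS : IsSemialgebraicFunOn ℚ S (fun z => g (z 1)) :=
      IsSemialgebraicFunOn.comp_isSemialgebraicMapOn_holds (g := fun t : Fin 1 → ℝ => g (t 0)) hg hproj
        fun z hz => (hSB hz).2
    have hden : IsSemialgebraicFunOn ℚ S (fun z => Real.sqrt (f (z 0)) * Real.sqrt (f (z 1))) :=
      IsSemialgebraicFunOn.mul_holds (isSemialgebraicFunOn_sqrt_cubic_apply hS h₂ h₃ hf 0)
        (isSemialgebraicFunOn_sqrt_cubic_apply hS h₂ h₃ hf 1)
    have hpos0 : ∀ z ∈ S, 0 < Real.sqrt (f (z 0)) := fun z hz =>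
      Real.sqrt_pos.2 (hpos _ (hSB hz).1)
    have hpos1 : ∀ z ∈ S, 0 < Real.sqrt (f (z 1)) := fun z hz =>
      Real.sqrt_pos.2 (hpos _ (hB (hSB hz).2))
    have hne : ∀ z ∈ S, Real.sqrt (f (z 0)) * Real.sqrt (f (z 1)) ≠ 0 := fun z hz =>
      (mul_pos (hpos0 z hz) (hpos1 z hz)).ne'
    have hsa : IsSemialgebraicFunOn ℚ S
        (fun z => g (z 1) / (Real.sqrt (f (z 0)) * Real.sqrt (f (z 1)))) := hgS.div hden hne
    have hmeasS : MeasurableSet S := IsSemialgebraic.measurableSet_holds hS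
    have hint' : IntegrableOn
        (fun z : Fin 2 → ℝ => g (z 1) / (Real.sqrt (f (z 0)) * Real.sqrt (f (z 1)))) S := by
      refine integrableOn_of_abs_le_const_mul_prod
        (hint.integrable_indicator measurableSet_Ioi) hmeasS
        (measurable_restrict_of_isSemialgebraicFunOn hsa) M fun z hz => ?_
      have hz0 : z 0 ∈ Ioi e₁ := (hSB hz).1
      have hz1 : z 1 ∈ Ioi e₁ := hB (hSB hz).2
      rw [Fin.prod_univ_two, indicator_of_mem hz0, indicator_of_mem hz1, abs_div,
        abs_of_pos (mul_pos (hpos0 z hz) (hpos1 z hz)), div_eq_mul_inv, mul_inv]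
      exact mul_le_mul_of_nonneg_right (hgM _ (hSB hz).2)
        (mul_nonneg (inv_nonneg.2 (hpos0 z hz).le) (inv_nonneg.2 (hpos1 z hz).le))
    exact ⟨⟨S, fun z => g (z 1) / (Real.sqrt (f (z 0)) * Real.sqrt (f (z 1))), hS, hsa, hint'⟩,
      rfl, rfl⟩

end Summit.KontsevichZagierPeriods.KontsevichZagierPeriods.Cruxes.NeronTorsionSector.Translation

end
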